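import Literature.AlgebraicGeometry.ShimuraVarieties.UnitaryShimuraCurveRecord
import Literature.AlgebraicGeometry.ShimuraVarieties.UnitaryBallNegConeChart
import Literature.AlgebraicGeometry.ShimuraVarieties.UnitaryBallConeChart
import Literature.NumberTheory.Automorphic.UnitaryGroupFrameEmbedding
import Literature.NumberTheory.Automorphic.UnitaryGroupFrameEmbeddingLevels
import HarnessLib

/-!
# The sub-ball inclusion `Sh_K⋆(U(J⋆), 𝔻)(ℂ) → Sh_K(U(H), 𝔹²)(ℂ)` on complex points (GS programme, leaf G4)

Topic `AlgebraicGeometry/ShimuraVarieties`, namespace `…UnitaryCanonicalModel` (continuation of ★ `UnitaryShimuraCurveRecord`).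
Definitions of maps (no `Prop` bodies) + PROVED lemmas; NO named fact, NO instance, NO `sorry`.  Cell `hodgecm-mathlib`
(D-0151), A-plan2's `GS-PROGRAMME.md` §9 A.11 leaf (G4), director g6 RULING s86 (2)(c) (banked generic capital; books 0).
HC_CM is proved only modulo the 7 printed citations until rung 0 closes.

For a CM field `L`, `H ∈ M₃(L)` hermitian of signature `(2,1)` at `τ` with Sylvester frame `T` (the datum of ★
`UnitaryGroup.ShimuraSet L H τ T hT K`) and an `L`-rational frame `ᵗ(cB)·(a·H)·B = J⋆ ⊕ J⊥` with `τ a > 0` real (★ `φGS`'s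
frame; `a = 1` at the `a3_liu418` face pin), the sub-datum `G⋆ = Res U(J⋆) ↪ G = Res U(H)` of the proof of [Liu2021, Thm. 4.15]
(«the Shimura variety `Sh(G⋆, h⋆)` together with the morphism `Sh(G⋆, h⋆) → Sh(G, h)` over `E`», FJcycle.tex l. 2193; `g⋆`
acts on the `V⋆`-variable only, l. 2203–2208) acts on COMPLEX POINTS by `[v, uK⋆] ↦ [𝔹(B^τ(v ⊕ 0)), φGS(u)K]` whenever
`φGS(K⋆) ≤ K`: `v` a negative vector of `J⋆^τ` (★ `ShimuraSetGS`, cone coordinates), `B^τ(v ⊕ 0)` its image in the negative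
cone of `H^τ` (★ `UnitaryGroupFrameEmbedding`), `𝔹(w) = proj(T⁻¹w)` the ball point through the frame (★ `negConeBallCoord`),
`φGS = R_B ∘ (· ⊕ 1)` (★ GS-2 §5) — [Milne2005ShimuraVarieties] Thm. 13.6 / (5.1) on `ℂ`-points, «the sub-ball inclusion up
to translates», the clause the memo's GS-5b / GS-7 consume.  Main decls: `negConeToBall`, `frameEmbNeg`, ★ `embRational`,
**`ShimuraSetGS.embPoints`** (+ `_mk`, `_mk_of_eq_smul_frame_lift`), `ShimuraSetGS.embPointsOne` (`a = 1`).  Nothing about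
canonical models is asserted.

## References
* [Liu2021] Y. Liu, Camb. J. Math. 9 (2021) = arXiv:2102.11518, proof of Thm. 4.15, FJcycle.tex l. 2193–2208 (pp. 50–51).
* [Milne2005ShimuraVarieties] J. S. Milne, *Introduction to Shimura varieties* (2005): (5.1) p. 56, Lemma 5.13 p. 57, Def. 12.5 p. 113, Thm. 13.6 p. 118.
* [Kudla1984] §1 · [PlatonovRapinchuk1994] §§2.3, 5.1 · [BergeronMillsonMoeglin2016Balls] Acta Math. 216 (2016), Part 2 §§1.1–1.3, §3.1.
-/

noncomputable section

open Function MulAction Matrix NumberField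
open scoped Matrix ComplexOrder
open Literature.Geometry.ComplexHyperbolic Literature.Geometry.ComplexHyperbolic.BallModel
open Literature.NumberTheory.Automorphic Literature.NumberTheory.Automorphic.UnitaryGroup

namespace Literature.AlgebraicGeometry.ShimuraVarieties

namespace UnitaryCanonicalModel

variable {L : Type} [Field L] [NumberField L] [IsCMField L] {H : Matrix (Fin 3) (Fin 3) L} {τ : L →+* ℂ} {T : GL (Fin 3) ℂ}

/-! ### §1. The ball point of a negative vector through the frame `T` -/

omit [NumberField L] [IsCMField L] in
/-- `T (T⁻¹ v) = v`. [folklore] -/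
private theorem mulVec_inv_mulVec' (T : GL (Fin 3) ℂ) (v : Fin 3 → ℂ) :
    (T : Matrix (Fin 3) (Fin 3) ℂ) *ᵥ (((T⁻¹ : GL (Fin 3) ℂ) : Matrix (Fin 3) (Fin 3) ℂ) *ᵥ v) = v := by
  rw [mulVec_mulVec, ← Units.val_mul, mul_inv_cancel, Units.val_one, one_mulVec]

omit [NumberField L] [IsCMField L] in
/-- **The ball point of a negative vector** `v` of `H^τ` through the Sylvester frame `T`: `𝔹(v) := proj (T⁻¹ v) ∈ 𝔹²` (the
negative line `ℂv` as a point of the bounded domain; ★ `negConeBallCoord` with its membership proof).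
[cite: Milne2005ShimuraVarieties, Def. 12.5 p. 113] [cite: BergeronMillsonMoeglin2016Balls, Part 2 §1.3] -/
def negConeToBall (hT : formCongr (starRingEnd ℂ) T (H.map τ) = BallModel.J) {v : Fin 3 → ℂ}
    (hv : v ∈ negCone (H.map τ)) : Ball :=
  BallModel.proj (((T⁻¹ : GL (Fin 3) ℂ) : Matrix (Fin 3) (Fin 3) ℂ) *ᵥ v) (Q_inv_mulVec_neg_of_mem_negCone hT hv)

omit [NumberField L] [IsCMField L] in
/-- The coordinates of `𝔹(v)` are the chart ★ `negConeBallCoord T v`. [cite: Milne2005ShimuraVarieties, Def. 12.5 p. 113] -/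
theorem negConeToBall_val (hT : formCongr (starRingEnd ℂ) T (H.map τ) = BallModel.J) {v : Fin 3 → ℂ}
    (hv : v ∈ negCone (H.map τ)) : (negConeToBall hT hv).1 = negConeBallCoord T v :=
  (negConeBallCoord_eq_proj hT hv).symm

omit [NumberField L] [IsCMField L] in
/-- `𝔹` depends only on the vector (proof-irrelevance helper for rewriting under the membership proof). [folklore] -/
private theorem negConeToBall_congr (hT : formCongr (starRingEnd ℂ) T (H.map τ) = BallModel.J) {v w : Fin 3 → ℂ}
    (hv : v ∈ negCone (H.map τ)) (hw : w ∈ negCone (H.map τ)) (h : v = w) :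
    negConeToBall hT hv = negConeToBall hT hw := by subst h; rfl

omit [NumberField L] [IsCMField L] in
/-- **`𝔹` is constant on punctured lines**: `𝔹(c v) = 𝔹(v)` for `c ≠ 0`. [cite: BergeronMillsonMoeglin2016Balls, Part 2 §1.3] -/
theorem negConeToBall_smul (hT : formCongr (starRingEnd ℂ) T (H.map τ) = BallModel.J) {c : ℂ} (hc : c ≠ 0)
    {v : Fin 3 → ℂ} (hv : v ∈ negCone (H.map τ)) (hcv : c • v ∈ negCone (H.map τ)) :
    negConeToBall hT hcv = negConeToBall hT hv := by
  unfold negConeToBall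
  simp only [mulVec_smul]
  exact UnitaryBallUniformisationDatum.proj_smul _ hc _

omit [NumberField L] [IsCMField L] in
/-- **`𝔹` inverts the frame lift**: `𝔹(T·(x, 1)) = x` (★ `frame_mulVec_lift_mem_negCone`).
[cite: Milne2005ShimuraVarieties, Def. 12.5 p. 113] -/
theorem negConeToBall_frame_lift (hT : formCongr (starRingEnd ℂ) T (H.map τ) = BallModel.J) (x : Ball) :
    negConeToBall hT (frame_mulVec_lift_mem_negCone hT x) = x := by
  refine BallModel.Ball.ext fun i => ?_
  rw [negConeToBall_val, negConeBallCoord_frame_lift]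

/-- **`U(H)(L⁺)`-equivariance of `𝔹`**: `γ ∈ U(H)(L⁺)` acts on the ball through `ρ(γ) = T⁻¹ γ^τ T ∈ U(2,1)` (★ `ratToU21`)
and `ρ(γ) • 𝔹(v) = 𝔹(γ^τ v)`. [cite: Milne2005ShimuraVarieties, Lemma 5.13 p. 57] [cite: BergeronMillsonMoeglin2016Balls, Part 2 §1.3] -/
theorem ratToU21_smul_negConeToBall (hT : formCongr (starRingEnd ℂ) T (H.map τ) = BallModel.J)
    (γ : rational (↥(maximalRealSubfield L)) L (IsCMField.complexConj L) 3 H) {v : Fin 3 → ℂ}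
    (hv : v ∈ negCone (H.map τ))
    (hγv : ((Matrix.GeneralLinearGroup.map τ (γ : GL (Fin 3) L) : GL (Fin 3) ℂ) : Matrix (Fin 3) (Fin 3) ℂ) *ᵥ v ∈
      negCone (H.map τ)) :
    ratToU21 L H τ T hT γ • negConeToBall hT hv = negConeToBall hT hγv := by
  have hQ := Q_inv_mulVec_neg_of_mem_negCone hT hv
  have h2 := BallModel.ne_zero_of_Q_neg hQ
  rw [BallModel.smul_def, BallModel.act]
  unfold negConeToBall
  have hmat : mat (ratToU21 L H τ T hT γ) =
      ((T⁻¹ : GL (Fin 3) ℂ) : Matrix (Fin 3) (Fin 3) ℂ) *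
        ((Matrix.GeneralLinearGroup.map τ (γ : GL (Fin 3) L) : GL (Fin 3) ℂ) : Matrix (Fin 3) (Fin 3) ℂ) *
        (T : Matrix (Fin 3) (Fin 3) ℂ) := by
    change (((archProjU21EmbCM L H τ T hT (rationalToArch (↥(maximalRealSubfield L)) L
      (IsCMField.complexConj L) 3 H γ) : U21) : GL (Fin 3) ℂ) : Matrix (Fin 3) (Fin 3) ℂ) = _
    rw [coe_archProjU21EmbCM_rationalToArch, Units.val_mul, Units.val_mul]
  have hW : BallModel.W3 (ratToU21 L H τ T hT γ) (BallModel.proj (((T⁻¹ : GL (Fin 3) ℂ) : Matrix (Fin 3) (Fin 3) ℂ) *ᵥ v) hQ) =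
      ((((T⁻¹ : GL (Fin 3) ℂ) : Matrix (Fin 3) (Fin 3) ℂ) *ᵥ v) 2)⁻¹ •
        (((T⁻¹ : GL (Fin 3) ℂ) : Matrix (Fin 3) (Fin 3) ℂ) *ᵥ
          (((Matrix.GeneralLinearGroup.map τ (γ : GL (Fin 3) L) : GL (Fin 3) ℂ) : Matrix (Fin 3) (Fin 3) ℂ) *ᵥ v)) := by
    rw [BallModel.W3, UnitaryBallUniformisationDatum.lift_proj, mulVec_smul, hmat, ← mulVec_mulVec, ← mulVec_mulVec,
      mulVec_inv_mulVec']
  simp only [hW]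
  exact UnitaryBallUniformisationDatum.proj_smul _ (inv_ne_zero h2) _

/-! ### §2. The first-summand frame embedding on complex vectors: `v ↦ B^τ (v ⊕ 0)` -/

section FrameEmb

variable (τ) (B : GL (Fin 3) L)

omit [NumberField L] [IsCMField L] in
/-- **The frame embedding on complex vectors** `v ↦ B^τ·(v ⊕ 0) ∈ ℂ³` (`τ`-points of `V⋆ ↪ V⋆ ⊕ V⋆^⊥` in the frame `B`;
`Fin.append` as in ★ `UnitaryGroupFrameEmbedding`). [cite: Kudla1984, §1] [cite: Liu2021, Thm. 4.15 proof (FJcycle.tex l. 2193–2203)] -/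
def frameEmbNeg (v : Fin 2 → ℂ) : Fin 3 → ℂ :=
  (B : Matrix (Fin 3) (Fin 3) L).map τ *ᵥ Fin.append v (0 : Fin 1 → ℂ)

omit [NumberField L] [IsCMField L] in
/-- `Fin.append (c • v) 0 = c • Fin.append v 0`. [folklore] -/
private theorem append_smul_zero (c : ℂ) (v : Fin 2 → ℂ) :
    Fin.append (c • v) (0 : Fin 1 → ℂ) = c • Fin.append v (0 : Fin 1 → ℂ) := by
  funext i; refine Fin.addCases (fun j => ?_) (fun j => ?_) i
  · simp only [Fin.append_left, Pi.smul_apply]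
  · simp only [Fin.append_right, Pi.smul_apply, Pi.zero_apply, smul_zero]

omit [NumberField L] [IsCMField L] in
/-- **`B^τ(· ⊕ 0)` is linear in the line**: `B^τ((c v) ⊕ 0) = c · B^τ(v ⊕ 0)`. [folklore] -/
private theorem frameEmbNeg_smul (c : ℂ) (v : Fin 2 → ℂ) : frameEmbNeg τ B (c • v) = c • frameEmbNeg τ B v := by
  unfold frameEmbNeg
  rw [append_smul_zero, mulVec_smul]

/-- Every complex embedding `τ` intertwines the CM involution (as the coerced algebra equivalence) with complex
conjugation. [folklore] -/
private theorem embedding_coe_complexConj' (x : L) :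
    τ (((IsCMField.complexConj L : L ≃ₐ[↥(maximalRealSubfield L)] L) : L →+* L) x) = starRingEnd ℂ (τ x) :=
  embedding_cmConjRingHom L τ x

variable {Jstar : Matrix (Fin 2) (Fin 2) L} {Jperp : Matrix (Fin 1) (Fin 1) L} {B} {a : L}

/-- **The frame embedding carries the disc into the ball**: for `ᵗ(cB)·(a·H)·B = J⋆ ⊕ J⊥` with `τ a` a POSITIVE REAL,
`B^τ(v ⊕ 0)` is `H^τ`-negative when `v` is `J⋆^τ`-negative (★ `re_hermForm_map_frameEmb_self_neg_iff`).
[cite: BergeronMillsonMoeglin2016Balls, Part 2 §1.3 and §3.1] -/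
theorem frameEmbNeg_mem_negCone
    (hB : formCongr ((IsCMField.complexConj L : L ≃ₐ[↥(maximalRealSubfield L)] L) : L →+* L) B (a • H) =
      finSum 2 1 Jstar Jperp)
    (hτa : 0 < (τ a).re) (hτa' : (τ a).im = 0) {v : Fin 2 → ℂ} (hv : v ∈ negCone (Jstar.map τ)) :
    frameEmbNeg τ B v ∈ negCone (H.map τ) :=
  (re_hermForm_map_frameEmb_self_neg_iff _ τ (embedding_coe_complexConj' τ) hτa hτa' hB v).2 hv

omit [NumberField L] [IsCMField L] in
/-- `τ 1 = 1` is a positive real: the hypotheses of `frameEmbNeg_mem_negCone` at the face pin's scalar `a = 1`. [folklore] -/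
private theorem re_map_one_pos : 0 < (τ (1 : L)).re := by rw [map_one, Complex.one_re]; exact one_pos

omit [NumberField L] [IsCMField L] in
/-- `τ 1 = 1` has no imaginary part. [folklore] -/
private theorem im_map_one_eq_zero : (τ (1 : L)).im = 0 := by rw [map_one, Complex.one_im]

/-- The case `a = 1` (the `a3_liu418` face pin's frame `ᵗ(cB)·((1 : L) • H)·B = J⋆ ⊕ J⊥`): `B^τ(v ⊕ 0)` is negative for
`H^τ` when `v` is for `J⋆^τ`. [cite: BergeronMillsonMoeglin2016Balls, Part 2 §1.3 and §3.1] -/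
theorem frameEmbNeg_mem_negCone_one
    (hB : formCongr ((IsCMField.complexConj L : L ≃ₐ[↥(maximalRealSubfield L)] L) : L →+* L) B ((1 : L) • H) =
      finSum 2 1 Jstar Jperp) {v : Fin 2 → ℂ} (hv : v ∈ negCone (Jstar.map τ)) :
    frameEmbNeg τ B v ∈ negCone (H.map τ) :=
  frameEmbNeg_mem_negCone τ hB (re_map_one_pos τ) (im_map_one_eq_zero τ) hv

end FrameEmb

/-! ### §3. The rational embedding `γ ↦ B·(γ ⊕ᶠ 1)·B⁻¹ : U(J⋆)(L⁺) → U(H)(L⁺)` (★ `embRational`) and its two compatibilities -/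

section Rational

variable (H) (Jstar : Matrix (Fin 2) (Fin 2) L) (Jperp : Matrix (Fin 1) (Fin 1) L) (B : GL (Fin 3) L) {a : L} (ha : a ≠ 0)
  (hB : formCongr ((IsCMField.complexConj L : L ≃ₐ[↥(maximalRealSubfield L)] L) : L →+* L) B (a • H) =
    finSum 2 1 Jstar Jperp)

/-- **Finite-adelic compatibility** `(B·(γ ⊕ᶠ 1)·B⁻¹)_f = φGS(γ_f)` for A-p03's ★ `embRational` (`γ ↦ B·(γ ⊕ᶠ 1)·B⁻¹ :
U(J⋆)(L⁺) →* U(H)(L⁺)`, the `ℚ`-points of `G⋆ ↪ G`) and GS-2's ★ `φGS` (★ `finAdelicCongr_finAdelicBlockDiag_rationalToFinAdelic`).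
[cite: PlatonovRapinchuk1994, §5.1] [cite: Liu2021, Thm. 4.15 proof (FJcycle.tex l. 2193–2208)] -/
theorem rationalToFinAdelic_embRational_eq_φGS (γ : rational (↥(maximalRealSubfield L)) L (IsCMField.complexConj L) 2 Jstar) :
    rationalToFinAdelic (↥(maximalRealSubfield L)) L (IsCMField.complexConj L) 3 H
        (embRational (↥(maximalRealSubfield L)) L (IsCMField.complexConj L) 2 1 Jstar Jperp H B ha hB γ) =
      φGS L Jstar Jperp H B ha hB
        (rationalToFinAdelic (↥(maximalRealSubfield L)) L (IsCMField.complexConj L) 2 Jstar γ) :=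
  (finAdelicCongr_finAdelicBlockDiag_rationalToFinAdelic (↥(maximalRealSubfield L)) L (IsCMField.complexConj L) 2 1
    Jstar Jperp H B ha hB γ).symm

/-- The matrix of `(γ ⊕ᶠ 1)^τ` is `γ^τ ⊕ᶠ 1`. [folklore] -/
private theorem coe_map_rationalBlockDiag_one
    (γ : rational (↥(maximalRealSubfield L)) L (IsCMField.complexConj L) 2 Jstar) :
    ((Matrix.GeneralLinearGroup.map τ
        (rationalBlockDiag (↥(maximalRealSubfield L)) L (IsCMField.complexConj L) 2 1 Jstar Jperp (γ, 1)).1 :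
          GL (Fin (2 + 1)) ℂ) : Matrix (Fin (2 + 1)) (Fin (2 + 1)) ℂ) =
      finSum 2 1 (((ratToGLℂ L Jstar τ γ : GL (Fin 2) ℂ) : Matrix (Fin 2) (Fin 2) ℂ)) 1 := by
  change (finSum 2 1 ((γ.1 : GL (Fin 2) L) : Matrix (Fin 2) (Fin 2) L) (((1 : rational (↥(maximalRealSubfield L)) L
    (IsCMField.complexConj L) 1 Jperp).1 : GL (Fin 1) L) : Matrix (Fin 1) (Fin 1) L)).map τ = _
  rw [finSum_map, coe_ratToGLℂ]
  congr 1
  change ((1 : GL (Fin 1) L) : Matrix (Fin 1) (Fin 1) L).map τ = 1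
  rw [Units.val_one, Matrix.map_one _ (map_zero τ) (map_one τ)]

/-- **Vector compatibility** `(B·(γ ⊕ᶠ 1)·B⁻¹)^τ · B^τ(v ⊕ 0) = B^τ(γ^τ v ⊕ 0)` (★ `conj_finSum_one_right_mulVec_frameEmb_zero`
read through `τ`). [cite: Kudla1984, §1] -/
theorem map_embRational_mulVec_frameEmbNeg
    (γ : rational (↥(maximalRealSubfield L)) L (IsCMField.complexConj L) 2 Jstar) (v : Fin 2 → ℂ) :
    ((Matrix.GeneralLinearGroup.map τ
        (embRational (↥(maximalRealSubfield L)) L (IsCMField.complexConj L) 2 1 Jstar Jperp H B ha hB γ).1 :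
          GL (Fin 3) ℂ) : Matrix (Fin 3) (Fin 3) ℂ) *ᵥ frameEmbNeg τ B v =
      frameEmbNeg τ B (((ratToGLℂ L Jstar τ γ : GL (Fin 2) ℂ) : Matrix (Fin 2) (Fin 2) ℂ) *ᵥ v) := by
  have hcoe : ((Matrix.GeneralLinearGroup.map τ
        (embRational (↥(maximalRealSubfield L)) L (IsCMField.complexConj L) 2 1 Jstar Jperp H B ha hB γ).1 :
          GL (Fin 3) ℂ) : Matrix (Fin 3) (Fin 3) ℂ) =
      ((Matrix.GeneralLinearGroup.map τ B : GL (Fin 3) ℂ) : Matrix (Fin 3) (Fin 3) ℂ) *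
        finSum 2 1 (((ratToGLℂ L Jstar τ γ : GL (Fin 2) ℂ) : Matrix (Fin 2) (Fin 2) ℂ)) 1 *
        (((Matrix.GeneralLinearGroup.map τ B)⁻¹ : GL (Fin 3) ℂ) : Matrix (Fin 3) (Fin 3) ℂ) := by
    rw [coe_embRational, map_mul, map_mul, map_inv, Units.val_mul, Units.val_mul, coe_map_rationalBlockDiag_one]
  rw [hcoe]
  exact conj_finSum_one_right_mulVec_frameEmb_zero (N₁ := 2) (N₂ := 1)
    (Matrix.GeneralLinearGroup.map τ (show GL (Fin (2 + 1)) L from B)) _ v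

end Rational

/-! ### §4. The map on Shimura sets -/

section Emb

variable (L H τ T) (hT : formCongr (starRingEnd ℂ) T (H.map τ) = BallModel.J)
  (Jstar : Matrix (Fin 2) (Fin 2) L) (Jperp : Matrix (Fin 1) (Fin 1) L) (B : GL (Fin 3) L) {a : L} (ha : a ≠ 0)
  (hB : formCongr ((IsCMField.complexConj L : L ≃ₐ[↥(maximalRealSubfield L)] L) : L →+* L) B (a • H) =
    finSum 2 1 Jstar Jperp)
  (hτa : 0 < (τ a).re) (hτa' : (τ a).im = 0)
  (Kstar : Subgroup ↥(finAdelic (↥(maximalRealSubfield L)) L (IsCMField.complexConj L) 2 Jstar))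
  (K : Subgroup ↥(finAdelic (↥(maximalRealSubfield L)) L (IsCMField.complexConj L) 3 H))
  (hK : Kstar.map (φGS L Jstar Jperp H B ha hB) ≤ K)

/-- The map on representatives `(v, u) ↦ [𝔹(B^τ(v ⊕ 0)), φGS(u)K]`. [cite: Milne2005ShimuraVarieties, §5 (5.1) p. 56] -/
private def embRep (v : ↥(negCone (Jstar.map τ)))
    (u : ↥(finAdelic (↥(maximalRealSubfield L)) L (IsCMField.complexConj L) 2 Jstar)) : ShimuraSet L H τ T hT K :=
  ShimuraSet.mk L H τ T hT K (negConeToBall hT (frameEmbNeg_mem_negCone τ hB hτa hτa' v.2))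
    (φGS L Jstar Jperp H B ha hB u)

include hK in
/-- `embRep` is constant on `K⋆`-cosets (inner well-definedness). [cite: Milne2005ShimuraVarieties, §5 (5.1) p. 56] -/
private theorem embRep_coset (v : ↥(negCone (Jstar.map τ)))
    (u u' : ↥(finAdelic (↥(maximalRealSubfield L)) L (IsCMField.complexConj L) 2 Jstar)) (huu' : u⁻¹ * u' ∈ Kstar) :
    embRep L H τ T hT Jstar Jperp B ha hB hτa hτa' K v u = embRep L H τ T hT Jstar Jperp B ha hB hτa hτa' K v u' := by
  unfold embRep
  rw [ShimuraSet.mk_eq_mk_iff]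
  refine ⟨1, by rw [map_one, one_smul], ?_⟩
  rw [map_one, one_mul, ← map_inv, ← map_mul]
  exact hK (Subgroup.mem_map_of_mem _ huu')

/-- The map on `negCone(J⋆^τ) × U(J⋆)(𝔸_f)/K⋆`, descended along the coset quotient. [cite: Milne2005ShimuraVarieties, §5 (5.1) p. 56] -/
private def embPair (p : ↥(negCone (Jstar.map τ)) ×
    (↥(finAdelic (↥(maximalRealSubfield L)) L (IsCMField.complexConj L) 2 Jstar) ⧸ Kstar)) : ShimuraSet L H τ T hT K :=
  Quotient.liftOn' p.2 (embRep L H τ T hT Jstar Jperp B ha hB hτa hτa' K p.1) fun u u' huu' =>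
    embRep_coset L H τ T hT Jstar Jperp B ha hB hτa hτa' Kstar K hK p.1 u u' (QuotientGroup.leftRel_apply.1 huu')

/-- `embPair (v, ↑u) = embRep v u`. [folklore] -/
private theorem embPair_mk (v : ↥(negCone (Jstar.map τ)))
    (u : ↥(finAdelic (↥(maximalRealSubfield L)) L (IsCMField.complexConj L) 2 Jstar)) :
    embPair L H τ T hT Jstar Jperp B ha hB hτa hτa' Kstar K hK
        (v, (u : ↥(finAdelic (↥(maximalRealSubfield L)) L (IsCMField.complexConj L) 2 Jstar) ⧸ Kstar)) =
      embRep L H τ T hT Jstar Jperp B ha hB hτa hτa' K v u :=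
  rfl

include hK in
/-- **Outer well-definedness**: for `c·γ^τ v′ = v`, `γ u′K⋆ = uK⋆` (`γ ∈ U(J⋆)(L⁺)`, `c ∈ ℂˣ`) the rational
`g = B·(γ ⊕ᶠ 1)·B⁻¹` carries `[𝔹(B^τ(v′ ⊕ 0)), φGS(u′)K]` to `[𝔹(B^τ(v ⊕ 0)), φGS(u)K]`. [cite: Milne2005ShimuraVarieties, Lemma 5.13 p. 57] -/
private theorem embPair_wd
    (p q : ↥(negCone (Jstar.map τ)) ×
      (↥(finAdelic (↥(maximalRealSubfield L)) L (IsCMField.complexConj L) 2 Jstar) ⧸ Kstar))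
    (hpq : gsRel L Jstar τ Kstar p q) :
    embPair L H τ T hT Jstar Jperp B ha hB hτa hτa' Kstar K hK p =
      embPair L H τ T hT Jstar Jperp B ha hB hτa hτa' Kstar K hK q := by
  obtain ⟨v, qu⟩ := p
  obtain ⟨v', qu'⟩ := q
  induction qu using QuotientGroup.induction_on with | H u => ?_
  induction qu' using QuotientGroup.induction_on with | H u' => ?_
  obtain ⟨γ, c, hc, hv, hu⟩ := hpq
  rw [embPair_mk, embPair_mk]
  unfold embRep
  rw [ShimuraSet.mk_eq_mk_iff]
  refine ⟨embRational (↥(maximalRealSubfield L)) L (IsCMField.complexConj L) 2 1 Jstar Jperp H B ha hB γ, ?_, ?_⟩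
  · -- ball: `ρ(g) • 𝔹(B^τ(v′ ⊕ 0)) = 𝔹(g^τ B^τ(v′ ⊕ 0)) = 𝔹(B^τ(γ^τ v′ ⊕ 0)) = 𝔹(c⁻¹ B^τ(v ⊕ 0)) = 𝔹(B^τ(v ⊕ 0))`
    have hγv' : (((ratToGLℂ L Jstar τ γ : GL (Fin 2) ℂ) : Matrix (Fin 2) (Fin 2) ℂ) *ᵥ (v'.1 : Fin 2 → ℂ)) =
        c⁻¹ • (v.1 : Fin 2 → ℂ) := by
      rw [← hv, smul_smul, inv_mul_cancel₀ hc, one_smul]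
    have hγv'neg : (((ratToGLℂ L Jstar τ γ : GL (Fin 2) ℂ) : Matrix (Fin 2) (Fin 2) ℂ) *ᵥ (v'.1 : Fin 2 → ℂ)) ∈
        negCone (Jstar.map τ) := hγv' ▸ smul_mem_negCone (inv_ne_zero hc) v.2
    have hneg : ((Matrix.GeneralLinearGroup.map τ
        (embRational (↥(maximalRealSubfield L)) L (IsCMField.complexConj L) 2 1 Jstar Jperp H B ha hB γ).1 :
          GL (Fin 3) ℂ) : Matrix (Fin 3) (Fin 3) ℂ) *ᵥ frameEmbNeg τ B (v'.1 : Fin 2 → ℂ) ∈ negCone (H.map τ) :=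
      (map_embRational_mulVec_frameEmbNeg H Jstar Jperp B ha hB γ _).symm ▸ frameEmbNeg_mem_negCone τ hB hτa hτa' hγv'neg
    rw [ratToU21_smul_negConeToBall hT _ _ hneg,
      negConeToBall_congr hT hneg (frameEmbNeg_mem_negCone τ hB hτa hτa' hγv'neg)
        (map_embRational_mulVec_frameEmbNeg H Jstar Jperp B ha hB γ _),
      negConeToBall_congr hT (frameEmbNeg_mem_negCone τ hB hτa hτa' hγv'neg)
        (smul_mem_negCone (inv_ne_zero hc) (frameEmbNeg_mem_negCone τ hB hτa hτa' v.2))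
        (by rw [hγv', frameEmbNeg_smul]),
      negConeToBall_smul hT (inv_ne_zero hc)]
  · -- coset: `(g)_f = φGS(γ_f)` and `u⁻¹ γ_f u′ ∈ K⋆`
    rw [rationalToFinAdelic_embRational_eq_φGS, ← map_inv, ← map_mul, ← map_mul]
    exact hK (Subgroup.mem_map_of_mem _ (QuotientGroup.eq.1 hu.symm))

/-- **The embedding on complex points of the sub-datum `G⋆ = Res U(J⋆) ↪ G = Res U(H)`**: `Sh_{K⋆}(U(J⋆), 𝔻)(ℂ) →
Sh_K(U(H), 𝔹²)(ℂ)`, `[v, uK⋆] ↦ [𝔹(B^τ(v ⊕ 0)), φGS(u)K]` for `φGS(K⋆) ≤ K` — «`Sh(G⋆, h⋆) → Sh(G, h)`» of the proof of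
[Liu2021, Thm. 4.15] on `ℂ`-points (sub-ball inclusion up to translates), by `Quotient.lift`.
[cite: Liu2021, Thm. 4.15 proof (FJcycle.tex l. 2193–2208)] [cite: Milne2005ShimuraVarieties, Lemma 5.13 p. 57, Thm. 13.6 p. 118] -/
def ShimuraSetGS.embPoints : ShimuraSetGS L Jstar τ Kstar → ShimuraSet L H τ T hT K :=
  Quotient.lift (embPair L H τ T hT Jstar Jperp B ha hB hτa hτa' Kstar K hK)
    (embPair_wd L H τ T hT Jstar Jperp B ha hB hτa hτa' Kstar K hK)

/-- **The formula**: `embPoints [v, uK⋆] = [𝔹(B^τ(v ⊕ 0)), φGS(u)K]`. [cite: Liu2021, Thm. 4.15 proof (FJcycle.tex l. 2193–2208)]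
[cite: Milne2005ShimuraVarieties, §5 (5.1) p. 56] -/
theorem ShimuraSetGS.embPoints_mk (v : Fin 2 → ℂ) (hv : v ∈ negCone (Jstar.map τ))
    (u : ↥(finAdelic (↥(maximalRealSubfield L)) L (IsCMField.complexConj L) 2 Jstar)) :
    ShimuraSetGS.embPoints L H τ T hT Jstar Jperp B ha hB hτa hτa' Kstar K hK (ShimuraSetGS.mk L Jstar τ Kstar v hv u) =
      ShimuraSet.mk L H τ T hT K (negConeToBall hT (frameEmbNeg_mem_negCone τ hB hτa hτa' hv))
        (φGS L Jstar Jperp H B ha hB u) :=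
  rfl

/-- **In the frame's disc coordinate**: if `B^τ(v ⊕ 0) = c · T·(x,1)` (`c ≠ 0`) then `embPoints [v, uK⋆] = [x, φGS(u)K]`
(the records' `pieces`/`unif` clauses speak of `T·lift x`). [cite: Milne2005ShimuraVarieties, Def. 12.5 p. 113, Lemma 5.13 p. 57] -/
theorem ShimuraSetGS.embPoints_mk_of_eq_smul_frame_lift (v : Fin 2 → ℂ) (hv : v ∈ negCone (Jstar.map τ))
    (u : ↥(finAdelic (↥(maximalRealSubfield L)) L (IsCMField.complexConj L) 2 Jstar)) (x : Ball) {c : ℂ} (hc : c ≠ 0)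
    (hx : frameEmbNeg τ B v = c • ((T : Matrix (Fin 3) (Fin 3) ℂ) *ᵥ BallModel.lift x)) :
    ShimuraSetGS.embPoints L H τ T hT Jstar Jperp B ha hB hτa hτa' Kstar K hK (ShimuraSetGS.mk L Jstar τ Kstar v hv u) =
      ShimuraSet.mk L H τ T hT K x (φGS L Jstar Jperp H B ha hB u) := by
  rw [ShimuraSetGS.embPoints_mk,
    negConeToBall_congr hT (frameEmbNeg_mem_negCone τ hB hτa hτa' hv)
      (smul_mem_negCone hc (frame_mulVec_lift_mem_negCone hT x)) hx,
    negConeToBall_smul hT hc (frame_mulVec_lift_mem_negCone hT x), negConeToBall_frame_lift]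

end Emb

/-! ### §5. The face-pin case `a = 1` (v16's `(1 : F) • Hm V`): the same map with the scalar hypotheses discharged -/

section EmbOne

variable (L H τ T) (hT : formCongr (starRingEnd ℂ) T (H.map τ) = BallModel.J)
  (Jstar : Matrix (Fin 2) (Fin 2) L) (Jperp : Matrix (Fin 1) (Fin 1) L) (B : GL (Fin 3) L)
  (hB₁ : formCongr ((IsCMField.complexConj L : L ≃ₐ[↥(maximalRealSubfield L)] L) : L →+* L) B ((1 : L) • H) =
    finSum 2 1 Jstar Jperp)
  (Kstar : Subgroup ↥(finAdelic (↥(maximalRealSubfield L)) L (IsCMField.complexConj L) 2 Jstar))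
  (K : Subgroup ↥(finAdelic (↥(maximalRealSubfield L)) L (IsCMField.complexConj L) 3 H))
  (hK : Kstar.map (φGS L Jstar Jperp H B one_ne_zero hB₁) ≤ K)

/-- **The embedding on complex points at the face pin's frame** `ᵗ(cB)·((1 : L) • H)·B = J⋆ ⊕ J⊥` (`(1 : F) • Hm V` in the
registered `a3_liu418` pin): `embPoints` with the scalar hypotheses discharged by `τ 1 = 1`.
[cite: Liu2021, Thm. 4.15 proof (FJcycle.tex l. 2193–2208)] [cite: Milne2005ShimuraVarieties, Thm. 13.6 p. 118] -/
def ShimuraSetGS.embPointsOne : ShimuraSetGS L Jstar τ Kstar → ShimuraSet L H τ T hT K :=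
  ShimuraSetGS.embPoints L H τ T hT Jstar Jperp B one_ne_zero hB₁ (re_map_one_pos τ) (im_map_one_eq_zero τ) Kstar K hK

/-- **The formula at `a = 1`**: `embPointsOne [v, uK⋆] = [𝔹(B^τ(v ⊕ 0)), φGS(u)K]`.
[cite: Liu2021, Thm. 4.15 proof (FJcycle.tex l. 2193–2208)] [cite: Milne2005ShimuraVarieties, §5 (5.1) p. 56] -/
theorem ShimuraSetGS.embPointsOne_mk (v : Fin 2 → ℂ) (hv : v ∈ negCone (Jstar.map τ))
    (u : ↥(finAdelic (↥(maximalRealSubfield L)) L (IsCMField.complexConj L) 2 Jstar)) :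
    ShimuraSetGS.embPointsOne L H τ T hT Jstar Jperp B hB₁ Kstar K hK (ShimuraSetGS.mk L Jstar τ Kstar v hv u) =
      ShimuraSet.mk L H τ T hT K (negConeToBall hT (frameEmbNeg_mem_negCone_one τ hB₁ hv))
        (φGS L Jstar Jperp H B one_ne_zero hB₁ u) :=
  rfl

/-- **At `a = 1`, in the frame's disc coordinate**: if `B^τ(v ⊕ 0) = c · T·(x, 1)` with `c ≠ 0`, then
`embPointsOne [v, uK⋆] = [x, φGS(u)K]`. [cite: Milne2005ShimuraVarieties, Def. 12.5 p. 113, Lemma 5.13 p. 57] -/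
theorem ShimuraSetGS.embPointsOne_mk_of_eq_smul_frame_lift (v : Fin 2 → ℂ) (hv : v ∈ negCone (Jstar.map τ))
    (u : ↥(finAdelic (↥(maximalRealSubfield L)) L (IsCMField.complexConj L) 2 Jstar)) (x : Ball) {c : ℂ} (hc : c ≠ 0)
    (hx : frameEmbNeg τ B v = c • ((T : Matrix (Fin 3) (Fin 3) ℂ) *ᵥ BallModel.lift x)) :
    ShimuraSetGS.embPointsOne L H τ T hT Jstar Jperp B hB₁ Kstar K hK (ShimuraSetGS.mk L Jstar τ Kstar v hv u) =
      ShimuraSet.mk L H τ T hT K x (φGS L Jstar Jperp H B one_ne_zero hB₁ u) :=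
  ShimuraSetGS.embPoints_mk_of_eq_smul_frame_lift L H τ T hT Jstar Jperp B one_ne_zero hB₁ (re_map_one_pos τ)
    (im_map_one_eq_zero τ) Kstar K hK v hv u x hc hx

end EmbOne

end UnitaryCanonicalModel

end Literature.AlgebraicGeometry.ShimuraVarieties

end
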